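import Summits.CriticalPhenomena.PercolationContinuityZ3.Theorems.PercNearOneGluingNoHeavyLowerTailSahiClassTSingleCube
import Summits.CriticalPhenomena.PercolationContinuityZ3.Theorems.PercNearOneGluingNoHeavyLowerTailSahiSharedTwoPoint
import Literature.Combinatorics.Sahi2008.PushForward
import Mathlib.Tactic.Linarith
import HarnessLib

/-!
# `NoHeavyLowerTail` (crux stmt-CriticalPhenomena-4575), P2 — **THEOREM A ON A SINGLE CUBE**: Kahn's `C_3` for every triple of increasing
# EVENTS `U₀, U₁, U₂ ⊆ 2^κ` in which two of the events share at most one essential coordinate (the third unrestricted)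

Support file (seat `prim-masterthm-p2`, gen 26; `--supports stmt-CriticalPhenomena-4575`; memo `FROM-prim-masterthm-p2-g26-LEX-CHAIN.md`).
No `sorry`, no new definitions, standard axioms.

WHY.  THEOREM A (`SahiSharedTwoPoint.sahiE_three_nonneg_cubes_sharedBit`, P2 gen 8) is stated on a product of THREE Boolean cubes
`2^C × 2^A × 2^B` with `C` a subsingleton (`f(c,a), g(c,b), h(c,a,b)`), whereas the core-induction engines of the programme (gen 25's
`…SahiLevelSplit`, master-conj's BGC reductions, `…SahiClassTCoreStep`) speak of events `U ⊆ 2^κ` on ONE cube with essential supports `esupp U`.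
Gen 14 built the bridge for CLASS T (`SahiClassTCube.glue3`, `sahiE_three_ind_eq_blocks`, where the third event must avoid the `f`–`g` block);
here the third event is ARBITRARY, which is what Theorem A needs.

* `sahiE_three_ind_eq_blocks_free` — for a block labelling `blk : κ → Fin 3` with `U₀` unaffected by block `2` and `U₁` by block `1` (no
  hypothesis on `U₂`): `E_3(μ_p; 1_{U₀},1_{U₁},1_{U₂})` is the three-block `E_3` of the pulled-back functions `f(c,a), g(c,b), h(c,a,b)`.
* `sahiE_three_nonneg_of_blocks_subsingleton` — if moreover block `0` has at most one coordinate: `E_3 ≥ 0` (Theorem A pulled back).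
* **`sahiE_three_nonneg_of_esupp_inter_subsingleton`** — for increasing `U₀, U₁, U₂ ⊆ 2^κ` with `(esupp U₀ ∩ esupp U₁)` of cardinality `≤ 1`
  and EVERY `p`: `0 ≤ E_3(bernoulliWeight p; 1_{U₀}, 1_{U₁}, 1_{U₂})` (blocks `C = esupp U₀ ∩ esupp U₁`, `A = esupp U₀ ∖ esupp U₁`, `B = (esupp U₀)ᶜ`);
  `…_subsingleton'` is the `Fin 3`-family form.
USE (companion file `…SahiSharedTwoPointCubeFace`): with gen 25's `SahiLevelSplit.sahiE_three_nonneg_of_levelDefect_nonneg` at a coin `c`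
this gives the `c`-DECOUPLING FACE of `T₁(|C| = 1)` (`f(z,c,a), g(z,c,b), h(z,a,b)`: Kahn's `C_3` whenever `2μ(hPQ) ≥ μ(h)μ(PQ)`, `P, Q` the
`c`-pivotal sets), complementary to the `z`-dominated half `…SahiT1LexChain` (memo §3).
HONEST FRAMING: `C_3` in general, `T₁` and `T₁(|C| = 1)` remain OPEN. [this work]
-/

noncomputable section

open scoped Classical

namespace Summit.CriticalPhenomena.PercolationContinuityZ3.Theorems

namespace SahiSharedTwoPointCube

open Finset Function
open Literature.Combinatorics.Sahi2008
open Literature.Probability.Percolation (DeterminedBy determinedBy_iff)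
open Literature.Probability.Percolation.DecisionTree (ind ind_of_mem ind_of_not_mem ind_nonneg)
open SahiClassTCube (glue3 glue3_mono pushWeight_glue3 ind_glue3_of_determinedBy_ne_two ind_glue3_of_determinedBy_ne_one)

variable {κ : Type} [Fintype κ] (blk : κ → Fin 3) (U₀ U₁ U₂ : Set (Set κ))

/-- **`E_3` of two events living on two blocks each and a third ARBITRARY event is the three-block `E_3`** of the pulled-back functions
`f(c,a) = 1_{U₀}(glue3 (a,∅,c))`, `g(c,b) = 1_{U₁}(glue3 (∅,b,c))`, `h(c,a,b) = 1_{U₂}(glue3 (a,b,c))` (push-forward along `glue3`). [this work] -/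
theorem sahiE_three_ind_eq_blocks_free (p : κ → unitInterval)
    (h₀ : DeterminedBy U₀ {x | blk x ≠ 2}) (h₁ : DeterminedBy U₁ {x | blk x ≠ 1}) :
    sahiE (bernoulliWeight p) 3 ![ind U₀, ind U₁, ind U₂] =
      sahiE (fun q : Set {x // blk x = 1} × Set {x // blk x = 2} × Set {x // blk x = 0} =>
          bernoulliWeight (fun a : {x // blk x = 1} => p a.1) q.1 * bernoulliWeight (fun b : {x // blk x = 2} => p b.1) q.2.1 *
            bernoulliWeight (fun c : {x // blk x = 0} => p c.1) q.2.2) 3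
        ![fun q => (fun (c : Set {x // blk x = 0}) (a : Set {x // blk x = 1}) => ind U₀ (glue3 blk (a, ∅, c))) q.2.2 q.1,
          fun q => (fun (c : Set {x // blk x = 0}) (b : Set {x // blk x = 2}) => ind U₁ (glue3 blk (∅, b, c))) q.2.2 q.2.1,
          fun q => (fun (c : Set {x // blk x = 0}) (a : Set {x // blk x = 1}) (b : Set {x // blk x = 2}) =>
            ind U₂ (glue3 blk (a, b, c))) q.2.2 q.1 q.2.1] := by
  rw [← pushWeight_glue3 blk p, sahiE_pushWeight]
  congr 1
  funext i q
  fin_cases i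
  · show ind U₀ (glue3 blk q) = ind U₀ (glue3 blk (q.1, ∅, q.2.2))
    exact ind_glue3_of_determinedBy_ne_two blk h₀ q
  · show ind U₁ (glue3 blk q) = ind U₁ (glue3 blk (∅, q.2.1, q.2.2))
    exact ind_glue3_of_determinedBy_ne_one blk h₁ q
  · rfl

variable {U₀ U₁ U₂}

/-- **THEOREM A in block form on one cube**: `U₀` unaffected by block `2`, `U₁` unaffected by block `1`, `U₂` arbitrary, block `0` (the
coordinates `U₀` and `U₁` may share) with at most one element ⟹ `E_3(μ_p; 1_{U₀},1_{U₁},1_{U₂}) ≥ 0` for every `p`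
(`SahiSharedTwoPoint.sahiE_three_nonneg_cubes_sharedBit` pulled back along `glue3`). [this work] -/
theorem sahiE_three_nonneg_of_blocks_subsingleton (hU₀ : IsUpperSet U₀) (hU₁ : IsUpperSet U₁) (hU₂ : IsUpperSet U₂)
    (h₀ : DeterminedBy U₀ {x | blk x ≠ 2}) (h₁ : DeterminedBy U₁ {x | blk x ≠ 1})
    (hC : ∀ x y, blk x = 0 → blk y = 0 → x = y) (p : κ → unitInterval) :
    0 ≤ sahiE (bernoulliWeight p) 3 ![ind U₀, ind U₁, ind U₂] := by
  haveI : Subsingleton {x // blk x = 0} := ⟨fun x y => Subtype.ext (hC x.1 y.1 x.2 y.2)⟩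
  rw [sahiE_three_ind_eq_blocks_free blk U₀ U₁ U₂ p h₀ h₁]
  exact SahiSharedTwoPoint.sahiE_three_nonneg_cubes_sharedBit (fun a : {x // blk x = 1} => p a.1)
    (fun b : {x // blk x = 2} => p b.1) (fun c : {x // blk x = 0} => p c.1)
    (fun c a => ind U₀ (glue3 blk (a, ∅, c))) (fun c b => ind U₁ (glue3 blk (∅, b, c))) (fun c a b => ind U₂ (glue3 blk (a, b, c)))
    (fun c a => ind_nonneg _ _) (fun c a a' haa => monotone_ind_of_isUpperSet hU₀ (glue3_mono blk haa le_rfl le_rfl))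
    (fun a c c' hcc => monotone_ind_of_isUpperSet hU₀ (glue3_mono blk le_rfl le_rfl hcc))
    (fun c b => ind_nonneg _ _) (fun c b b' hbb => monotone_ind_of_isUpperSet hU₁ (glue3_mono blk le_rfl hbb le_rfl))
    (fun b c c' hcc => monotone_ind_of_isUpperSet hU₁ (glue3_mono blk le_rfl le_rfl hcc))
    (fun c a b => ind_nonneg _ _) (fun a b c c' hcc => monotone_ind_of_isUpperSet hU₂ (glue3_mono blk le_rfl le_rfl hcc))
    (fun c b a a' haa => monotone_ind_of_isUpperSet hU₂ (glue3_mono blk haa le_rfl le_rfl))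
    (fun c a b b' hbb => monotone_ind_of_isUpperSet hU₂ (glue3_mono blk le_rfl hbb le_rfl))

/-- **THEOREM A ON ONE CUBE (Kahn's `C_3` when two members share at most one essential coordinate).**  For increasing events
`U₀, U₁, U₂ ⊆ 2^κ` such that at most one coordinate is essential to both `U₀` and `U₁` (`U₂` unrestricted) and EVERY product measure `μ_p`:
`0 ≤ E_3(μ_p; 1_{U₀}, 1_{U₁}, 1_{U₂})`.  (P2 gen 8's THEOREM A `SahiSharedTwoPoint.sahiE_three_nonneg_cubes_sharedBit`, transported to one cube with
the blocks `C = esupp U₀ ∩ esupp U₁`, `A = esupp U₀ ∖ esupp U₁`, `B = (esupp U₀)ᶜ`.) [this work] -/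
theorem sahiE_three_nonneg_of_esupp_inter_subsingleton (hU₀ : IsUpperSet U₀) (hU₁ : IsUpperSet U₁) (hU₂ : IsUpperSet U₂)
    (hC : ∀ x y, x ∈ esupp U₀ → x ∈ esupp U₁ → y ∈ esupp U₀ → y ∈ esupp U₁ → x = y) (p : κ → unitInterval) :
    0 ≤ sahiE (bernoulliWeight p) 3 ![ind U₀, ind U₁, ind U₂] := by
  let blk : κ → Fin 3 := fun x => if x ∈ esupp U₀ then (if x ∈ esupp U₁ then 0 else 1) else 2
  refine sahiE_three_nonneg_of_blocks_subsingleton blk hU₀ hU₁ hU₂ ?_ ?_ ?_ p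
  · refine (determinedBy_esupp hU₀).mono fun x hx => ?_
    have hx' : x ∈ esupp U₀ := hx
    simp only [Set.mem_setOf_eq, blk, hx', if_true]
    split_ifs <;> decide
  · refine (determinedBy_esupp hU₁).mono fun x hx => ?_
    have hx' : x ∈ esupp U₁ := hx
    simp only [Set.mem_setOf_eq, blk, hx', if_true]
    split_ifs <;> decide
  · intro x y hx hy
    have hx0 : x ∈ esupp U₀ := by
      by_contra h; simp only [blk, h, if_false] at hx; exact absurd hx (by decide)
    have hx1 : x ∈ esupp U₁ := by
      by_contra h; simp only [blk, hx0, h, if_true, if_false] at hx; exact absurd hx (by decide)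
    have hy0 : y ∈ esupp U₀ := by
      by_contra h; simp only [blk, h, if_false] at hy; exact absurd hy (by decide)
    have hy1 : y ∈ esupp U₁ := by
      by_contra h; simp only [blk, hy0, h, if_true, if_false] at hy; exact absurd hy (by decide)
    exact hC x y hx0 hx1 hy0 hy1

/-- The same for a `Fin 3`-family of events. [this work] -/
theorem sahiE_three_nonneg_of_esupp_inter_subsingleton' (U : Fin 3 → Set (Set κ)) (hU : ∀ i, IsUpperSet (U i))
    (hC : ∀ x y, x ∈ esupp (U 0) → x ∈ esupp (U 1) → y ∈ esupp (U 0) → y ∈ esupp (U 1) → x = y) (p : κ → unitInterval) :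
    0 ≤ sahiE (bernoulliWeight p) 3 (fun i => ind (U i)) := by
  have h : (fun i => ind (U i)) = ![ind (U 0), ind (U 1), ind (U 2)] := by
    funext i; fin_cases i <;> rfl
  rw [h]
  exact sahiE_three_nonneg_of_esupp_inter_subsingleton (hU 0) (hU 1) (hU 2) hC p

end SahiSharedTwoPointCube

end Summit.CriticalPhenomena.PercolationContinuityZ3.Theorems
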